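/-
Copyright (c) 2026. All rights reserved.
Released under Apache 2.0 license as described in the file LICENSE.
Authors: abc-iut cell — seat abc-iut-w5-d226 (wave 5).
-/
import Literature.AnabelianGeometry.AbsoluteAnabelian.AutHolomorphicSpaces
import Mathlib.Topology.LocalAtTarget
import Mathlib.Topology.Maps.Proper.Basic
import HarnessLib

/-!
# Finite étale morphisms compose ([AbsTopIII] Def 2.1 (ii) / Rmk 2.3.3 — the `IsFiniteEtale` half)

S. Mochizuki, *Topics in absolute anabelian geometry III*, Def 2.1 (ii) p.51 (finite étale local
morphisms), Rmk 2.3.3 p.54 ("any composite of morphisms of Aut-holomorphic spaces is again a morphism"),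
Def 4.1 (ii)/(iii) pp.102–103 (the categories `𝒞^hol_T`, `EA` whose morphisms are FINITE ÉTALE morphisms)
— bib key `MochizukiAbsTopIII2015`, kurims pages.  Proof-only (kind=proof; no new notions) over
abc-iut-L4-t2's `IsFiniteEtale φ := IsCoveringMap φ ∧ ∀ y, (φ ⁻¹' {y}).Finite`
(`AutHolomorphicSpaces.lean`).  The `IsMorphism` half of Rmk 2.3.3 is `IsMorphism.comp`
(`AutHolomorphicSpacesProofs.lean`); what was missing for packaging `EA` / `𝒞^hol_T` as categories
(sub-DAG `plan/L4/SUBDAG-AbsTopIII-Prop42.md`, rows P42.i/L08–L11) is the classical fact that FINITE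
covering maps compose.  Classical topology [folklore]:

* `isClosedMap_of_isCoveringMap_of_finite` — a covering map with finite fibres is a closed map
  (closedness is local on the target, `IsOpenCover.isClosedMap_iff_restrictPreimage`; over an evenly
  covered open the map is the projection `U × I → U` with `I` finite, hence closed);
* `IsFiniteEtale.isClosedMap`, `IsFiniteEtale.isProperMap`;
* `IsFiniteEtale.comp` — for a Hausdorff source: local homeomorphisms compose, finite fibres compose,
  closed maps compose, and a closed local homeomorphism with finite fibres from a Hausdorff space is a
  covering map (Mathlib `IsClosedMap.isCoveringMapOn_of_isLocalHomeomorphOn`).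

Refereed/classical; nothing here bears on the disputed [IUTchIII] Cor. 3.12.
-/

namespace Literature.AnabelianGeometry.AbsoluteAnabelian

open _root_.TopologicalSpace _root_.Topology _root_.Set

universe u

variable {X : Type u} [TopologicalSpace X] {Y : Type u} [TopologicalSpace Y] {Z : Type u}
  [TopologicalSpace Z]

/-- A covering map with finite fibres is a closed map: closedness is local on the target, and over an
evenly covered open set the map is (homeomorphic to) the projection `U × I → U` with `I` finite.
[folklore] [cite: MochizukiAbsTopIII2015, Definition 2.1 (ii) p.51] -/
theorem isClosedMap_of_isCoveringMap_of_finite {f : X → Y} (hf : IsCoveringMap f)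
    (hfin : ∀ y, (f ⁻¹' {y}).Finite) : IsClosedMap f := by
  classical
  choose U hxU hUo hfU H hH using fun y => (hf y).2
  have hcov : IsOpenCover (fun y : Y => (⟨U y, hUo y⟩ : Opens Y)) :=
    IsOpenCover.of_sets hUo (Set.eq_univ_of_forall fun y => Set.mem_iUnion.2 ⟨y, hxU y⟩)
  rw [hcov.isClosedMap_iff_restrictPreimage]
  intro y
  have : Finite (f ⁻¹' {y}) := (hfin y).to_subtype
  have hEq : (U y).restrictPreimage f = Prod.fst ∘ H y := by
    funext e
    apply Subtype.ext
    simp only [Function.comp_apply, hH]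
    rfl
  change IsClosedMap ((U y).restrictPreimage f)
  rw [hEq]
  exact isClosedMap_fst_of_compactSpace.comp (H y).isClosedMap

/-- A finite étale morphism is a closed map. [folklore]
[cite: MochizukiAbsTopIII2015, Definition 2.1 (ii) p.51] -/
theorem IsFiniteEtale.isClosedMap {φ : X → Y} (h : IsFiniteEtale φ) : IsClosedMap φ :=
  isClosedMap_of_isCoveringMap_of_finite h.isCoveringMap h.finite_fibre

/-- A finite étale morphism is a proper map (closed with compact — indeed finite — fibres). [folklore]
[cite: MochizukiAbsTopIII2015, Definition 2.1 (ii) p.51] -/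
theorem IsFiniteEtale.isProperMap {φ : X → Y} (h : IsFiniteEtale φ) : IsProperMap φ := by
  rw [isProperMap_iff_isClosedMap_and_compact_fibers]
  exact ⟨h.isCoveringMap.continuous, h.isClosedMap, fun y => (h.finite_fibre y).isCompact⟩

omit [TopologicalSpace X] [TopologicalSpace Y] [TopologicalSpace Z] in
/-- The fibres of a composite of maps with finite fibres are finite.
[cite: MochizukiAbsTopIII2015, Remark 2.3.3 p.54] -/
theorem finite_preimage_comp_singleton {φ : X → Y} {ψ : Y → Z} (hφ : ∀ y, (φ ⁻¹' {y}).Finite)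
    (hψ : ∀ z, (ψ ⁻¹' {z}).Finite) (z : Z) : ((ψ ∘ φ) ⁻¹' {z}).Finite := by
  rw [Set.preimage_comp]
  exact (hψ z).preimage' fun y _ => hφ y

/-- **Finite étale morphisms compose** (the `IsFiniteEtale` half of Rmk 2.3.3: "any composite of
morphisms of Aut-holomorphic spaces is again a morphism"; together with `IsMorphism.comp` this is what
makes `EA`, `𝒞^hol_T` categories), for a Hausdorff source: the composite is a closed local homeomorphism
with finite fibres, hence a covering map. [folklore]
[cite: MochizukiAbsTopIII2015, Remark 2.3.3 p.54] -/
theorem IsFiniteEtale.comp [T2Space X] {φ : X → Y} {ψ : Y → Z} (hψ : IsFiniteEtale ψ)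
    (hφ : IsFiniteEtale φ) : IsFiniteEtale (ψ ∘ φ) := by
  have hfin := finite_preimage_comp_singleton hφ.finite_fibre hψ.finite_fibre
  refine ⟨?_, hfin⟩
  rw [isCoveringMap_iff_isCoveringMapOn_univ]
  refine (hψ.isClosedMap.comp hφ.isClosedMap).isCoveringMapOn_of_isLocalHomeomorphOn
    (fun z _ => hfin z) ?_
  rw [Set.preimage_univ, ← isLocalHomeomorph_iff_isLocalHomeomorphOn_univ]
  exact hψ.isCoveringMap.isLocalHomeomorph.comp hφ.isCoveringMap.isLocalHomeomorph

/-! ### Homeomorphisms are finite étale (identities / structure-isomorphisms of `EA`, `𝒞^hol_T`) -/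

/-- **A homeomorphism is a finite étale morphism** — a covering map (trivialised over the whole target
with one-point fibre) with finite (one-point) fibres; so identities and structure-isomorphisms are
morphisms of the categories `EA`, `𝒞^hol_T` (Def 4.1 (ii)/(iii)). [folklore]
[cite: MochizukiAbsTopIII2015, Definition 2.1 (ii) p.51] -/
theorem IsFiniteEtale.of_homeomorph (e : X ≃ₜ Y) : IsFiniteEtale e := by
  have hfib : ∀ y, (e ⁻¹' {y}) = {e.symm y} := fun y => by
    ext x
    simp only [Set.mem_preimage, Set.mem_singleton_iff]
    constructor
    · intro h
      rw [← h, Homeomorph.symm_apply_apply]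
    · intro h
      rw [h, Homeomorph.apply_symm_apply]
  refine ⟨fun y => ?_, fun y => by rw [hfib]; exact Set.finite_singleton _⟩
  have hsub : Subsingleton (e ⁻¹' {y}) := by rw [hfib]; infer_instance
  refine ⟨inferInstance, Set.univ, Set.mem_univ _, isOpen_univ, by rw [Set.preimage_univ]; exact isOpen_univ,
    ?_⟩
  refine ⟨{ toFun := fun x => (⟨e x.1, Set.mem_univ _⟩, ⟨e.symm y, by simp⟩)
            invFun := fun p => ⟨e.symm p.1.1, by simp⟩
            left_inv := fun x => Subtype.ext (e.symm_apply_apply x.1)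
            right_inv := fun p => Prod.ext (Subtype.ext (e.apply_symm_apply p.1.1)) (Subsingleton.elim _ _)
            continuous_toFun := by fun_prop
            continuous_invFun := by fun_prop }, fun _ => rfl⟩

/-- The identity is finite étale. [folklore] [cite: MochizukiAbsTopIII2015, Definition 2.1 (ii) p.51] -/
theorem IsFiniteEtale.id : IsFiniteEtale (id : X → X) :=
  IsFiniteEtale.of_homeomorph (Homeomorph.refl X)

end Literature.AnabelianGeometry.AbsoluteAnabelian
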